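import Summits.ResolutionOfSingularities.ResolutionOfSingularities.Theorems.EquisingularLiftEquisingularLiftSingFiniteOfLeTwo
import Literature.AlgebraicGeometry.CossartPiltant200819.Thm21ProjectiveMorphisms2008
import Literature.AlgebraicGeometry.Resolution.BlowupsComposition
import Literature.AlgebraicGeometry.Resolution.BlowupsFlatBaseChange
import Literature.AlgebraicGeometry.Resolution.ExcellentRingsFieldProofs
import Literature.Topology.KrullDimensionDrop
import Mathlib.Topology.KrullDimension
import Mathlib.AlgebraicGeometry.Morphisms.ClosedImmersion
import HarnessLib

/-!
# Crux `EquisingularLift` (stmt-ResolutionOfSingularities-15660), line `Sketch`, skeleton v10: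
# stub `stub_blowupModel_three` — regular projective blow-up models of integral surfaces in `ℙ³_k`

[OURS · L1 W4.5b] AI-produced, weaker than expert review; NOT a statement of any manuscript.

The `n = 3` downstairs residual of the LINEAR-CENTRE reduction (lead `res-L1-w45b-lead-1`,
skeleton v10): every integral closed subscheme `H ⊆ ℙ³_k` with locally principal ideal (an integral
surface, or `ℙ³_k` itself) carries a non-zero ideal sheaf `𝔞` ALL of whose blow-ups are regular.

Proof. `H` is Noetherian and of finite type over the field `k`, hence excellent
(`Scheme.isExcellent_of_locallyOfFiniteType` with the discharged `Stacks07QW_field_holds`).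
* If `dim H ≤ 2`: the NAMED FACT `CossartJannsenSaito2020Sequence` (Cossart–Jannsen–Saito 2009/2020,
  Introduction Thm. 1 = Lipman 1978 in blow-up form; taken as a HYPOTHESIS — the result is
  CONDITIONAL on it) gives a resolution `π : X' → H` which is a finite sequence of blow-ups in centres
  lying in the non-regular loci (`IsSingularBlowupSequence π`). By Stacks 080B
  (`IsBlowup.exists_isBlowup_comp_supported`, iterated along the sequence:
  `exists_isBlowup_supported_of_isSingularBlowupSequence`) `π` is ONE blow-up of `H` along an ideal
  sheaf `𝔞` supported in `(Reg H)ᶜ`; each successive centre lies over `(Reg H)ᶜ` because a blow-up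
  is a local isomorphism off its centre (`mem_regularLocus_iff_of_isIso_morphismRestrict`). Then
  `𝔞 ≠ ⊥` since the generic point of `H` is regular, and every blow-up of `𝔞` is isomorphic to the
  regular `X'` (`IsBlowup.unique`).
* Otherwise `dim H ≥ 3 = dim ℙ³_k`, so the closed immersion is an isomorphism
  (`isIso_of_isClosedImmersion_projectiveSpace_of_not_dim_lt`), `H ≅ ℙ³_k` is regular
  (`isRegular_projectiveSpace`) and `𝔞 = ⊤` works (the identity is the blow-up of `⊤`).

References: [CossartJannsenSaito2020, Introduction Thm. 1 (arXiv:0905.2191 p. 2)];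
[StacksProject, Tag 080B; Tag 02OS]; [GortzWedhorn2020, (13.19) p. 413].
-/

set_option linter.dupNamespace false -- mandated namespace `Summit.<Summit>.<Problem>` of this single-conjunct summit

noncomputable section

open CategoryTheory AlgebraicGeometry TopologicalSpace Topology
open Literature.AlgebraicGeometry.Resolution Literature.AlgebraicGeometry.Motives

universe u

namespace Summit.ResolutionOfSingularities.ResolutionOfSingularities.Cruxes.EquisingularLift.StrataSplit

/-! ## A finite sequence of blow-ups in singular centres is one blow-up supported in `Sing` -/

/-- **A Cossart–Jannsen–Saito sequence of blow-ups in singular centres of a Noetherian scheme is ONE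
blow-up along an ideal sheaf supported in the non-regular locus** (Stacks 080B iterated; each centre
`D_i ⊆ (X_i)_{sing}` lies over `X_{sing}` because the composite blow-up `X_i → X` is a local
isomorphism over `Reg X ⊆ X ∖ Supp`, Stacks 02OS). [cite: StacksProject, Tag 080B] -/
theorem exists_isBlowup_supported_of_isSingularBlowupSequence :
    ∀ {X' X : Scheme.{u}} {π : X' ⟶ X}, IsSingularBlowupSequence π → IsNoetherian X →
      ∃ K : X.IdealSheafData, IsBlowup π K ∧ (K.support : Set X) ⊆ (Scheme.regularLocus X)ᶜ := by
  intro X' X π h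
  induction h with
  | id X => exact fun _ => ⟨⊤, isBlowup_id_top _, by simp [Scheme.IdealSheafData.support_top]⟩
  | @comp X'' X' X σ π D hσ hD hπ ih =>
    intro hN
    haveI := hN
    obtain ⟨K, hK, hKsupp⟩ := ih hN
    refine IsBlowup.exists_isBlowup_comp_supported π K σ D (Scheme.regularLocus X)ᶜ hK hKsupp hσ ?_
    intro y hy hyreg
    -- `π y ∈ Reg X ⊆ X ∖ Supp K`, over which `π` is an isomorphism: `y` is a regular point of `X'`
    haveI := hK.isIso_compl
    have hyU : π y ∈ (⟨(K.support : Set X)ᶜ, K.support.isClosed.isOpen_compl⟩ : X.Opens) :=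
      fun hmem => hKsupp hmem hyreg
    exact hD hy ((mem_regularLocus_iff_of_isIso_morphismRestrict π _ y hyU).mpr hyreg)

/-! ## Closed subschemes of `ℙⁿ_k` of dimension `≥ n` -/

/-- A closed immersion `ι : H ↪ ℙⁿ_k` (`k` a field) from a scheme whose topological Krull dimension
is NOT `< n` is an isomorphism: `dim ℙⁿ_k = n`, a proper closed subset of the irreducible `ℙⁿ_k` has
dimension `< n`, so `ι` is surjective, and a surjective closed immersion onto a reduced scheme is an
isomorphism. [folklore] -/
theorem isIso_of_isClosedImmersion_projectiveSpace_of_not_dim_lt {k : Type u} [Field k] {n : ℕ}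
    {H : Scheme.{u}} (ι : H ⟶ (projectiveSpace n k).left) [IsClosedImmersion ι]
    (hdim : ¬ topologicalKrullDim H < (n : ℕ)) : IsIso ι := by
  haveI hint : IsIntegral (projectiveSpace n k).left := isIntegral_projectiveSpace n k
  haveI : SmoothOfRelativeDimension n (projectiveSpace n k).hom :=
    (isSmoothProjective_projectiveSpace_holds k n).smoothOfRelativeDimension
  have hdimP : topologicalKrullDim ↥(projectiveSpace n k).left = (n : ℕ) :=
    topologicalKrullDim_eq_of_smoothOfRelativeDimension (projectiveSpace n k).hom n
  -- the image of `ι` is all of `ℙⁿ_k`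
  have hcl : IsClosed (Set.range ι.base) := ι.isClosedEmbedding.isClosed_range
  have hrange : Set.range ι.base = Set.univ := by
    by_contra hne
    apply hdim
    have hP : topologicalKrullDim ↥(projectiveSpace n k).left < (n + 1 : ℕ) := by
      rw [hdimP]
      exact_mod_cast Nat.lt_succ_self n
    have hlt := Literature.Topology.topologicalKrullDim_lt_of_isClosed_ssubset hcl hne n hP
    have heq : topologicalKrullDim H = topologicalKrullDim (Set.range ι.base) :=
      IsHomeomorph.topologicalKrullDim_eq _ ι.isClosedEmbedding.isEmbedding.toHomeomorph.isHomeomorph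
    exact heq ▸ hlt
  haveI : Surjective ι := ⟨Set.range_eq_univ.mp hrange⟩
  exact isIso_of_isClosedImmersion_of_surjective ι

/-- `d < m + 1 → d ≤ m` in `WithBot ℕ∞` (the value type of `topologicalKrullDim`). [folklore] -/
theorem withBotENat_le_of_lt_add_one {d : WithBot ℕ∞} {m : ℕ} (h : d < (m + 1 : ℕ)) : d ≤ m := by
  induction d using WithBot.recBotCoe with
  | bot => exact bot_le
  | coe e =>
    have h' : e < (m + 1 : ℕ) := by
      have : (e : WithBot ℕ∞) < ((m + 1 : ℕ) : ℕ∞) := h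
      exact WithBot.coe_lt_coe.mp this
    have h1 : e ≤ m := by
      rw [Nat.cast_add, Nat.cast_one] at h'
      exact Order.le_of_lt_add_one h'
    exact_mod_cast h1

/-! ## Regular schemes have a regular blow-up model -/

/-- A non-empty regular scheme has a non-zero ideal sheaf all of whose blow-ups are regular: the unit
ideal sheaf `⊤`, whose blow-ups are isomorphisms (the identity is one, GW remark after Def. 13.90,
and blow-ups are unique up to isomorphism). [cite: GortzWedhorn2020, (13.19) p. 413] -/
theorem exists_blowupModel_of_isRegular {H : Scheme.{u}} [Nonempty H] (hH : Scheme.IsRegular H) :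
    ∃ 𝔞 : H.IdealSheafData, 𝔞 ≠ ⊥ ∧
      ∀ (Z : Scheme.{u}) (π : Z ⟶ H), IsBlowup π 𝔞 → Scheme.IsRegular Z := by
  refine ⟨⊤, fun h => ?_, fun Z π hπ => ?_⟩
  · have hs := congrArg (fun I : H.IdealSheafData => (I.support : Set H)) h
    simp only [Scheme.IdealSheafData.support_top, Scheme.IdealSheafData.support_bot,
      Closeds.coe_bot, Closeds.coe_top] at hs
    exact (Set.empty_ne_univ hs).elim
  · obtain ⟨e, -, -⟩ := (isBlowup_id_top H).unique hπ
    exact hH.of_iso e.hom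

/-! ## The stub -/

/-- **STUB `stub_blowupModel_three`** of skeleton v10 (`n = 3`, surfaces), as `stub_blowupModel_three_of_CJS`: CONDITIONAL on the named
fact `CossartJannsenSaito2020Sequence` (Cossart–Jannsen–Saito, Introduction Thm. 1: resolution of
reduced excellent schemes of dimension `≤ 2` by a finite sequence of blow-ups in singular centres;
published theorem, not proved in the tree — supplied as the first argument, after which the type is
the registered signature verbatim). Every integral closed subscheme `H ⊆ ℙ³_k` (`k` algebraically
closed of characteristic `p`; only "`k` a field" is used) with locally principal ideal has a non-zero
ideal sheaf `𝔞` all of whose blow-ups are regular: for `dim H ≤ 2` fold the Cossart–Jannsen–Saito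
sequence into one blow-up supported in `(Reg H)ᶜ ∌` generic point (Stacks 080B,
`exists_isBlowup_supported_of_isSingularBlowupSequence`) and transport regularity along
`IsBlowup.unique`; otherwise `H = ℙ³_k` is regular and `𝔞 = ⊤`.
[cite: CossartJannsenSaito2020, Introduction Thm. 1 (arXiv:0905.2191 p. 2)]
[cite: StacksProject, Tag 080B] -/
theorem stub_blowupModel_three_of_CJS (hCJS : CossartJannsenSaito2020Sequence.{0}) : ∀ p : ℕ, p.Prime → ∀ (k : Type) [Field k] [CharP k p] [IsAlgClosed k] (n : ℕ) (H : AlgebraicGeometry.Scheme.{0}) (ι : H ⟶ (Literature.AlgebraicGeometry.Motives.projectiveSpace n k).left), AlgebraicGeometry.IsClosedImmersion ι → AlgebraicGeometry.IsIntegral H → (∀ y : (Literature.AlgebraicGeometry.Motives.projectiveSpace n k).left, ∃ U : (Literature.AlgebraicGeometry.Motives.projectiveSpace n k).left.affineOpens, y ∈ (U : (Literature.AlgebraicGeometry.Motives.projectiveSpace n k).left.Opens) ∧ (ι.ker.ideal U).IsPrincipal) → n = 3 → ∃ 𝔞 : H.IdealSheafData, 𝔞 ≠ ⊥ ∧ ∀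 (Z : AlgebraicGeometry.Scheme.{0}) (π : Z ⟶ H), Literature.AlgebraicGeometry.Resolution.IsBlowup π 𝔞 → Literature.AlgebraicGeometry.Resolution.Scheme.IsRegular Z := by
  intro _ _ k _ _ _ n H ι hι hH _ hn
  subst hn
  obtain ⟨hN, -⟩ := isNoetherian_and_isQuasiExcellent_of_isClosedImmersion_projectiveSpace 3 ι
  by_cases hdim : topologicalKrullDim H ≤ 2
  · -- `H` is an integral excellent surface: Cossart–Jannsen–Saito
    haveI : IsProper (projectiveSpace 3 k).hom := isProper_projectiveSpace 3 k
    have hexc : Scheme.IsExcellent H :=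
      Scheme.isExcellent_of_locallyOfFiniteType Stacks07QW_field_holds (ι ≫ (projectiveSpace 3 k).hom)
    obtain ⟨X', π, hres, hseq, -⟩ := hCJS H hexc hdim
    obtain ⟨K, hK, hKsupp⟩ := exists_isBlowup_supported_of_isSingularBlowupSequence hseq hN
    refine ⟨K, fun h0 => ?_, fun Z π' hπ' => ?_⟩
    · -- `K = ⊥` would put the (regular) generic point in `Supp K ⊆ (Reg H)ᶜ`
      have hmem : genericPoint H ∈ (K.support : Set H) := by
        rw [h0, Scheme.IdealSheafData.support_bot]; trivial
      exact hKsupp hmem (genericPoint_mem_regularLocus H)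
    · obtain ⟨e, -, -⟩ := hK.unique hπ'
      exact hres.isRegular.of_iso e.hom
  · -- `H = ℙ³_k`
    have hdim' : ¬ topologicalKrullDim H < (3 : ℕ) := fun h => hdim (withBotENat_le_of_lt_add_one h)
    haveI : IsIso ι := isIso_of_isClosedImmersion_projectiveSpace_of_not_dim_lt ι hdim'
    exact exists_blowupModel_of_isRegular
      (Scheme.IsRegular.of_iso (inv ι) (isRegular_projectiveSpace 3 k))

end Summit.ResolutionOfSingularities.ResolutionOfSingularities.Cruxes.EquisingularLift.StrataSplit

end
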